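import Literature.NumberTheory.EllipticCurves.IsogenyKummerSequenceProofs
import Literature.NumberTheory.EllipticCurves.SelmerFiniteProofs
import Literature.NumberTheory.EllipticCurves.X1ElevenDescentLocal
import Literature.NumberTheory.GaloisRepresentations.GlobalCharacterUnramifiedOfCoprime
import HarnessLib

/-!
# Selmer classes of an isogeny with constant kernel vanish on inertia (Mazur's étale-kernel
# descent, local half)

PROOF-ONLY file (theorems, no definition, no named fact), topic `NumberTheory/EllipticCurves`.
Let `E/K` be an elliptic curve over a number field and `φ : E → E'` an isogeny whose kernel
`E[φ] ⊆ E(K̄)` is **constant** — every point of `E[φ]` is fixed by `Γ_K` (e.g. `E[φ] = ⟨T⟩` for a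
rational torsion point `T`, B. Mazur, *Modular curves and the Eisenstein ideal*, Publ. Math. IHÉS
47 (1977), Ch. III §3: the descent through `C ≅ ℤ/n`). Then `H¹(K, E[φ]) = Hom_cont(Γ_K, E[φ])`,
and a class of the `φ`-Selmer group `Sel^φ(E/K)` (tree `WeierstrassCurve.Isogeny.selmerGroup`,
file `IsogenySelmerGroups`) is a continuous homomorphism `χ : Γ_K → E[φ]`. We prove that `χ`
**vanishes on the inertia group `I_𝔓 ≤ Γ_K` of every prime `𝔓` of `\bar ℤ_K`** above a finite
place `v` of either of the following two kinds:

* §2 `apply_eq_zero_of_mem_inertia_of_val_Δ` — **étale primes**: `E` is given by an equation with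
  integer coefficients `W = W₀ ⊗ K`, `W₀ : WeierstrassCurve ℤ`, whose discriminant is a `v`-unit,
  and the non-zero points of `E[φ]` are affine points with integer coordinates. This INCLUDES the
  primes dividing `deg φ` (Mazur, loc. cit., Ch. III §5 p. 157: "`ℤ/N ⊂ E` is étale over all of
  `Spec ℤ`", so the local condition at `N` is the unramified one). Proof: the tree's local engine
  `map_ne_add_of_val_Δ` (file `X1ElevenDescentLocal`, Silverman VIII.§1 proof of Prop. 1.5(b)) —
  an inertial Galois translate of a local point by a non-zero integral point would reduce to a
  singular point — run on `E(K̄_v)` with the spectral valuation of `K̄_v` (file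
  `SelmerFiniteProofs`) and the local–global compatibility of inertia (Neukirch II (9.6), tree
  `exists_mem_inertia_apply_eq_holds`).
* §3 `apply_eq_zero_of_mem_inertia_of_coprime` — **tame primes**: `v ∤ n` and
  `gcd(n, N v - 1) = 1`, where `n • E[φ] = 0`: no local condition is needed, every global
  continuous homomorphism `Γ_K → E[φ]` is unramified at `v` (file
  `GlobalCharacterUnramifiedOfCoprime`; Mazur, Ch. I §1(g): a `ℤ/p`-extension of `ℚ` ramifies only
  at `p` and at primes `ℓ ≡ 1 (mod p)`).

§1 records that Selmer classes are homomorphisms (`exists_hom_of_mem` / the cocycle identity with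
trivial action) and §2 first treats the prime `𝔓_{ι,𝔐}` cut out by the chosen embedding
`K̄ → K̄_v`, then all primes above `v` by conjugation (`Γ_K` is transitive on them and `E[φ]` is
abelian).

## References

* [Mazur1977] B. Mazur, *Modular curves and the Eisenstein ideal*, Publ. Math. IHÉS 47 (1977),
  Ch. I §1(g), Ch. III §3 and §5 (p. 157, Step 3 p. 159).
* [SilvermanAEC2009] J. H. Silverman, *The Arithmetic of Elliptic Curves*, 2nd ed., VIII.§1
  proof of Prop. 1.5(b), X.§4 proof of Thm. 4.2(b) and Cor. 4.4.
* [NeukirchANT1999] J. Neukirch, *Algebraic Number Theory*, Ch. II §9 Prop. (9.6).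

## Design

Theorems only; conventions of `SelmerInertia` / `SelmerFiniteProofs` (`K : Type u`,
`open scoped Classical`). The kernel `E[φ]` carries the action `Isogeny.kerAction` (supplied by
`letI`, as in `IsogenySelmerGroups`).
-/

noncomputable section

open scoped Classical NNReal Pointwise
open NumberField IsDedekindDomain Field
open Literature.NumberTheory.EllipticCurves Literature.NumberTheory.GaloisRepresentations

universe u

namespace Literature.NumberTheory.EllipticCurves

namespace ConstantKernelDescent

variable {K : Type u} [Field K] {W W' : WeierstrassCurve K} (φ : WeierstrassCurve.Isogeny W W')

/-! ## §1 Cocycles with values in a constant kernel are homomorphisms -/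

/-- For an isogeny with constant kernel (`Γ_K` fixes `E[φ]` pointwise), a continuous `1`-cocycle
`ψ : Γ_K → E[φ]` is a homomorphism: `ψ(στ) = ψ(σ) + ψ(τ)` (the cocycle identity
`ψ(στ) = ψ(σ) + σ ψ(τ)` with trivial action; Silverman, *AEC*, X.§4 / App. B §2:
`H¹(G, M) = Hom(G, M)` for a trivial `G`-module). [cite: SilvermanAEC2009, App. B Remark 1.1 / X.§4] -/
theorem cocycle_mul_of_constant
    (hconst : ∀ (σ : absoluteGaloisGroup K) (P : W.geomPoints), P ∈ φ.toAddMonoidHom.ker → σ • P = P)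
    (ψ : letI := φ.kerAction
      contOneCocycles (discreteTopRep (absoluteGaloisGroup K) φ.toAddMonoidHom.ker))
    (σ τ : absoluteGaloisGroup K) : ψ.1 (σ * τ) = ψ.1 σ + ψ.1 τ := by
  letI := φ.kerAction
  have h := ψ.2 σ τ
  have htriv : (discreteTopRep (absoluteGaloisGroup K) φ.toAddMonoidHom.ker).ρ σ (ψ.1 τ) = ψ.1 τ := by
    change σ • ψ.1 τ = ψ.1 τ
    exact Subtype.ext (hconst σ _ (ψ.1 τ).2)
  rw [htriv] at h
  exact h

/-- With constant kernel, a continuous `1`-cocycle `ψ : Γ_K → E[φ]` vanishes at `1` and satisfies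
`ψ(σ⁻¹) = -ψ(σ)`. [cite: SilvermanAEC2009, App. B Remark 1.1 / X.§4] -/
theorem cocycle_inv_of_constant
    (hconst : ∀ (σ : absoluteGaloisGroup K) (P : W.geomPoints), P ∈ φ.toAddMonoidHom.ker → σ • P = P)
    (ψ : letI := φ.kerAction
      contOneCocycles (discreteTopRep (absoluteGaloisGroup K) φ.toAddMonoidHom.ker))
    (σ : absoluteGaloisGroup K) : ψ.1 σ⁻¹ = - ψ.1 σ := by
  letI := φ.kerAction
  have h1 : ψ.1 1 = 0 := contOneCocycles.apply_one ψ
  have h := cocycle_mul_of_constant φ hconst ψ σ σ⁻¹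
  rw [mul_inv_cancel, h1] at h
  exact (neg_eq_of_add_eq_zero_right h.symm).symm

/-- With constant kernel, the values of a cocycle on conjugate elements agree:
`ψ(g⁻¹ σ g) = ψ(σ)` (`E[φ]` is abelian). [cite: SilvermanAEC2009, App. B Remark 1.1 / X.§4] -/
theorem cocycle_conj_of_constant
    (hconst : ∀ (σ : absoluteGaloisGroup K) (P : W.geomPoints), P ∈ φ.toAddMonoidHom.ker → σ • P = P)
    (ψ : letI := φ.kerAction
      contOneCocycles (discreteTopRep (absoluteGaloisGroup K) φ.toAddMonoidHom.ker))
    (g σ : absoluteGaloisGroup K) : ψ.1 (g⁻¹ * σ * g) = ψ.1 σ := by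
  letI := φ.kerAction
  rw [cocycle_mul_of_constant φ hconst, cocycle_mul_of_constant φ hconst,
    cocycle_inv_of_constant φ hconst]
  abel

/-! ## §2 Étale primes: the local Selmer condition forces vanishing on inertia -/

section Etale

variable [NumberField K]

omit [NumberField K] in
/-- Two affine points with equal coordinates are equal (proof-irrelevant form). [folklore] -/
private theorem some_congr {R : Type*} [CommRing R] {V : WeierstrassCurve R} {x y x' y' : R}
    (hx : x = x') (hy : y = y') (h : V.toAffine.Nonsingular x y)
    (h' : V.toAffine.Nonsingular x' y') :
    WeierstrassCurve.Affine.Point.some x y h = WeierstrassCurve.Affine.Point.some x' y' h' := by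
  subst hx hy; rfl

omit [NumberField K] in
/-- Conjugation by `g` carries the inertia group of `𝔓` onto that of `g • 𝔓`:
`σ ∈ I_{g • 𝔓} → g⁻¹ σ g ∈ I_𝔓`. [cite: NeukirchANT1999, Ch. I §9 Prop. (9.4)] -/
theorem conj_inv_mem_inertia {𝔓 𝔓' : Ideal (absIntegers (𝓞 K) K)} {g : absoluteGaloisGroup K}
    (hg : g • 𝔓 = 𝔓') {σ : absoluteGaloisGroup K} (hσ : σ ∈ 𝔓'.inertia (absoluteGaloisGroup K)) :
    g⁻¹ * σ * g ∈ 𝔓.inertia (absoluteGaloisGroup K) := by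
  intro x
  have h1 : (g⁻¹ * σ * g) • x - x = g⁻¹ • (σ • (g • x) - g • x) := by
    simp only [smul_sub, mul_smul, inv_smul_smul]
  rw [Submodule.mem_toAddSubgroup, h1]
  have h2 : σ • (g • x) - g • x ∈ g • 𝔓 := by rw [hg]; exact hσ (g • x)
  exact Ideal.mem_pointwise_smul_iff_inv_smul_mem.mp h2

/-- **The local Selmer condition at an étale prime kills the cocycle on inertia (one embedding).**
Let `W = W₀ ⊗ K` have integer coefficients (`W₀ : WeierstrassCurve ℤ`) with `Δ(W₀)` a `v`-unit, let
`φ : E → E'` be an isogeny with constant kernel whose non-zero points are affine with integer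
coordinates, and let `ψ : Γ_K → E[φ]` be a continuous cocycle whose class satisfies the local
Selmer condition at `v` (it dies in `H¹(K_v, E)`). Then `ψ(τ) = 0` for every `τ` in the inertia
group of the prime `𝔓_{ι,𝔐}` of `\bar ℤ_K` cut out by the chosen embedding `K̄ → K̄_v`. Proof:
`ψ(τ) = P^σ - P` for a local point `P ∈ E(K̄_v)` and a lift `σ` of `τ` to the inertia group of
`K̄_v` (Neukirch II (9.6)); if `ψ(τ) = T₀ ≠ O` then `P^σ = P + T₀` with `T₀` integral, which the
local engine `map_ne_add_of_val_Δ` (an inertial translate by a non-zero integral point reduces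
to a singular point; `|Δ|_v = 1`) forbids. This is Silverman's reduction step (X.§4 proof of
Thm. 4.2(b)) in the form valid also at the primes dividing `deg φ` (Mazur: `ℤ/N ⊂ E` étale over
`Spec ℤ`). [cite: Mazur1977, Ch. III §5 (p. 157)] [cite: SilvermanAEC2009, X.§4 proof of Thm. 4.2(b)] -/
theorem apply_eq_zero_of_mem_inertia_primeBelow_of_val_Δ [W.IsElliptic]
    (W₀ : WeierstrassCurve ℤ) (hW : W = W₀.map (Int.castRingHom K))
    (hint : ∀ P : W.geomPoints, P ∈ φ.toAddMonoidHom.ker → P ≠ 0 →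
      ∃ (a b : ℤ) (h : (W.baseChange (AlgebraicClosure K)).toAffine.Nonsingular
        (a : AlgebraicClosure K) (b : AlgebraicClosure K)),
        P = WeierstrassCurve.Affine.Point.some _ _ h)
    {v : HeightOneSpectrum (𝓞 K)} (hΔ : ((W₀.Δ : ℤ) : 𝓞 K) ∉ v.asIdeal)
    (ψ : letI := φ.kerAction
      contOneCocycles (discreteTopRep (absoluteGaloisGroup K) φ.toAddMonoidHom.ker))
    (hψ : letI := φ.kerAction
      oneCocycleClass _ ψ ∈ φ.selmerLocalKer (v.adicCompletion K))
    {𝔐 : Ideal v.localAbsIntegers} (h𝔐 : 𝔐 ∈ v.localPrimesAbove)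
    {τ : absoluteGaloisGroup K}
    (hτ : τ ∈ (v.primeBelow (closureEmb (K := K) (v.adicCompletion K)) 𝔐).inertia
      (absoluteGaloisGroup K)) :
    ψ.1 τ = 0 := by
  letI := φ.kerAction
  set E := v.adicCompletion K
  set L := AlgebraicClosure (v.adicCompletion K)
  set ι : AlgebraicClosure K →ₐ[K] L := closureEmb (K := K) E with hιdef
  -- the local condition: `ψ(res x) ↦ x • P - P` on `Γ_{K_v}`
  obtain ⟨P, hP⟩ := (oneCocycleClass_mem_resKer_iff (resGal (K := K) E)
    ((pointsMap W E).comp φ.toAddMonoidHom.ker.subtype)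
    (fun x Q ↦ pointsMap_smul W E x (Q : W.geomPoints)) ψ).mp hψ
  -- lift `τ` to the local inertia group
  obtain ⟨σ, hσI, hσ⟩ := v.exists_mem_inertia_apply_eq_holds ι h𝔐 hτ
  have hres : resGal (K := K) E σ = τ := by
    rw [resGal_eq]; exact resGalOfEmb_eq_of_apply_eq ι hσ
  have hT : pointsMap W E ((ψ.1 τ : φ.toAddMonoidHom.ker) : W.geomPoints) = σ • P - P := by
    have := hP σ
    rw [hres] at this
    exact this
  by_contra hne
  have hne' : ((ψ.1 τ : φ.toAddMonoidHom.ker) : W.geomPoints) ≠ 0 := fun h ↦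
    hne (Subtype.ext h)
  obtain ⟨a, b, hab, heq⟩ := hint _ (ψ.1 τ).2 hne'
  -- the spectral valuation and the integral model
  obtain ⟨w, hw⟩ := v.exists_spectralValuation
  haveI hintW : (W.baseChange L).IsIntegral w.integer := by
    refine isIntegral_integer_of_val_le_one ?_ ?_ ?_ ?_ ?_ <;>
      simp only [WeierstrassCurve.baseChange, WeierstrassCurve.map_a₁, WeierstrassCurve.map_a₂,
        WeierstrassCurve.map_a₃, WeierstrassCurve.map_a₄, WeierstrassCurve.map_a₆, hW] <;>
      exact (map_intCast (algebraMap K L) _).symm ▸ val_intCast_le_one w _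
  have hΔ1 : w (W.baseChange L).Δ = 1 := by
    rw [WeierstrassCurve.baseChange, WeierstrassCurve.map_Δ, hW, WeierstrassCurve.map_Δ,
      eq_intCast, map_intCast]
    exact HeightOneSpectrum.spectralValuation_intCast_eq_one hw hΔ
  -- `σ` as a `K`-automorphism of `L`: an inertial isometry
  set σ' : L ≃ₐ[K] L :=
    AlgEquiv.restrictScalars K (show L ≃ₐ[E] L from σ) with hσ'
  have hσapp : ∀ z : L, σ' z = σ • z := fun z ↦ rfl
  have hσw : ∀ z : L, w (σ' z) = w z := fun z ↦ by
    rw [hσapp]; exact HeightOneSpectrum.spectralValuation_smul hw σ z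
  have hσI' : ∀ z : L, w z ≤ 1 → w (σ' z - z) < 1 := fun z hz ↦ by
    rw [hσapp]
    exact (HeightOneSpectrum.mem_inertia_iff_spectralValuation hw h𝔐).mp hσI z hz
  -- the integral point `T₀ = ι(a, b)` in `E(K̄_v)`
  obtain ⟨hst, hT₀⟩ : ∃ hst, pointsMapOfEmb W ι (WeierstrassCurve.Affine.Point.some _ _ hab) =
      (WeierstrassCurve.Affine.Point.some (ι (a : AlgebraicClosure K)) (ι (b : AlgebraicClosure K))
        hst : localPoints W E) :=
    ⟨_, WeierstrassCurve.Affine.Point.map_some (W' := W.toAffine) (F := AlgebraicClosure K) ι hab⟩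
  have hs : w (ι (a : AlgebraicClosure K)) ≤ 1 := by
    rw [show (a : AlgebraicClosure K) = ((a : ℤ) : AlgebraicClosure K) from rfl, map_intCast]
    exact val_intCast_le_one w a
  rw [heq, show pointsMap W E = pointsMapOfEmb W ι from rfl] at hT
  -- case analysis on `P`
  set T₀ : localPoints W E := pointsMapOfEmb W ι (WeierstrassCurve.Affine.Point.some _ _ hab)
    with hT₀def
  have h3 : σ • P = P + T₀ := by
    rw [← sub_eq_iff_eq_add']; exact hT.symm
  rcases P with _ | ⟨x, y, hxy⟩
  · have h0 : σ • (show localPoints W E from WeierstrassCurve.Affine.Point.zero) = 0 := smul_zero σ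
    rw [h0] at h3
    have h4 : T₀ = 0 := left_eq_add.mp h3
    rw [hT₀] at h4
    exact WeierstrassCurve.Affine.Point.some_ne_zero _ h4
  · have hrel : WeierstrassCurve.Affine.Point.map (σ' : L →ₐ[K] L)
        (WeierstrassCurve.Affine.Point.some x y hxy) =
        WeierstrassCurve.Affine.Point.some x y hxy + WeierstrassCurve.Affine.Point.some _ _ hst := by
      rw [← hT₀]
      exact h3
    exact map_ne_add_of_val_Δ (F₀ := K) (L := L) (w := w) W hΔ1 σ' hσw hσI' hxy hst hs hrel

/-- **The local Selmer condition at an étale prime kills the cocycle on every inertia group above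
`v`.** Same hypotheses as `apply_eq_zero_of_mem_inertia_primeBelow_of_val_Δ`; conclusion for every
prime `𝔓` of `\bar ℤ_K` above `v` (`Γ_K` is transitive on these primes,
`exists_smul_eq_of_mem_primesAbove_holds`, inertia groups are conjugate and the cocycle is a
homomorphism to the abelian group `E[φ]`: Silverman's remark that unramifiedness does not depend
on the extension of `v`, VIII.§2 / X.4.1.1). [cite: Mazur1977, Ch. III §5 (p. 157)]
[cite: SilvermanAEC2009, X.§4 proof of Thm. 4.2(b) and Remark X.4.1.1] -/
theorem apply_eq_zero_of_mem_inertia_of_val_Δ [W.IsElliptic]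
    (W₀ : WeierstrassCurve ℤ) (hW : W = W₀.map (Int.castRingHom K))
    (hconst : ∀ (σ : absoluteGaloisGroup K) (P : W.geomPoints), P ∈ φ.toAddMonoidHom.ker → σ • P = P)
    (hint : ∀ P : W.geomPoints, P ∈ φ.toAddMonoidHom.ker → P ≠ 0 →
      ∃ (a b : ℤ) (h : (W.baseChange (AlgebraicClosure K)).toAffine.Nonsingular
        (a : AlgebraicClosure K) (b : AlgebraicClosure K)),
        P = WeierstrassCurve.Affine.Point.some _ _ h)
    {v : HeightOneSpectrum (𝓞 K)} (hΔ : ((W₀.Δ : ℤ) : 𝓞 K) ∉ v.asIdeal)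
    (ψ : letI := φ.kerAction
      contOneCocycles (discreteTopRep (absoluteGaloisGroup K) φ.toAddMonoidHom.ker))
    (hψ : letI := φ.kerAction
      oneCocycleClass _ ψ ∈ φ.selmerLocalKer (v.adicCompletion K))
    {𝔓 : Ideal (absIntegers (𝓞 K) K)} (h𝔓 : 𝔓 ∈ v.primesAbove)
    {τ : absoluteGaloisGroup K} (hτ : τ ∈ 𝔓.inertia (absoluteGaloisGroup K)) :
    ψ.1 τ = 0 := by
  letI := φ.kerAction
  obtain ⟨𝔐, h𝔐⟩ := v.localPrimesAbove_nonempty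
  obtain ⟨g, hg⟩ := HeightOneSpectrum.exists_smul_eq_of_mem_primesAbove_holds
    (HeightOneSpectrum.primeBelow_mem_primesAbove
      (ι := closureEmb (K := K) (v.adicCompletion K)) h𝔐) h𝔓
  have h1 := apply_eq_zero_of_mem_inertia_primeBelow_of_val_Δ φ W₀ hW hint hΔ ψ hψ h𝔐
    (conj_inv_mem_inertia hg hτ)
  rwa [cocycle_conj_of_constant φ hconst] at h1

end Etale

/-! ## §3 Tame primes: no local condition needed -/

section Tame

variable [NumberField K]

/-- **At a tame prime a constant-kernel cocycle vanishes on inertia, with no local condition.**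
If `n • E[φ] = 0`, `v ∤ n` and `gcd(n, N v - 1) = 1`, then every continuous `1`-cocycle
`ψ : Γ_K → E[φ]` (constant kernel) vanishes on `I_𝔓` for all `𝔓 ∣ v`
(`GlobalCharacter.apply_eq_zero_of_mem_inertia_of_coprime`: `(N v - 1) ψ(σ) = 0 = n ψ(σ)`).
For `K = ℚ`, `E[φ] ≅ ℤ/p`: the bad primes `ℓ ≢ 1 (mod p)`, `ℓ ≠ p`, impose nothing.
[cite: Mazur1977, Ch. I §1(g)] -/
theorem apply_eq_zero_of_mem_inertia_of_coprime
    (hconst : ∀ (σ : absoluteGaloisGroup K) (P : W.geomPoints), P ∈ φ.toAddMonoidHom.ker → σ • P = P)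
    {n : ℕ} (hn : 0 < n) (hkill : ∀ P : W.geomPoints, P ∈ φ.toAddMonoidHom.ker → n • P = 0)
    {v : HeightOneSpectrum (𝓞 K)} (hnv : (n : 𝓞 K) ∉ v.asIdeal)
    (hcop : Nat.Coprime n (v.residueCard - 1))
    (ψ : letI := φ.kerAction
      contOneCocycles (discreteTopRep (absoluteGaloisGroup K) φ.toAddMonoidHom.ker))
    {𝔓 : Ideal (absIntegers (𝓞 K) K)} (h𝔓 : 𝔓 ∈ v.primesAbove)
    {τ : absoluteGaloisGroup K} (hτ : τ ∈ 𝔓.inertia (absoluteGaloisGroup K)) :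
    ψ.1 τ = 0 := by
  letI := φ.kerAction
  haveI : Finite φ.toAddMonoidHom.ker := φ.finite_ker
  exact GlobalCharacter.apply_eq_zero_of_mem_inertia_of_coprime v hn hnv hcop h𝔓
    (T := φ.toAddMonoidHom.ker) (fun t ↦ Subtype.ext (by
      rw [AddSubmonoidClass.coe_nsmul, ZeroMemClass.coe_zero]; exact hkill _ t.2))
    (fun s ↦ ψ.1 s) ψ.1.continuous (cocycle_mul_of_constant φ hconst ψ) hτ

end Tame

end ConstantKernelDescent

end Literature.NumberTheory.EllipticCurves

end
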